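import Mathlib
import Literature.NumberTheory.Automorphic.ResGLnKugaCuspidal
import Literature.NumberTheory.Automorphic.ResGLnKugaAdInvariance
import Literature.NumberTheory.Automorphic.ResGLnKugaHarmonicRel
import Literature.NumberTheory.Automorphic.ResGLnConeDictionaryCone
import Literature.NumberTheory.Automorphic.CuspidalPeterssonForm
import Literature.NumberTheory.Automorphic.ResGLnCuspidalCohomologyApexBasic
import Summits.Langlands.Langlands.Theorems.IrreducibilityBySelfDualityHeckeEigenvalueFieldStubEndPairing
import Summits.Langlands.Langlands.Theorems.IrreducibilityBySelfDualityHeckeEigenvalueFieldStubEndFD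
import Summits.Langlands.Langlands.Theorems.IrreducibilityBySelfDualityHeckeEigenvalueFieldStubEndDstar
import Summits.Langlands.Langlands.Theorems.IrreducibilityBySelfDualityHeckeEigenvalueFieldStubEndDT
import Summits.Langlands.Langlands.Theorems.IrreducibilityBySelfDualityHeckeEigenvalueFieldStubAdjointTwo
import Summits.Langlands.Langlands.Theorems.IrreducibilityBySelfDualityHeckeEigenvalueFieldStubRelExt
import HarnessLib

/-! Route `IrreducibilityBySelfDuality`, crux `HeckeEigenvalueField`, line `Sketch`: the algebraic end-game
`stub_asm_end_main` (two-space adjoint lemma on the tuple model). [cite: Borel1981StableRealII, Thm. 5.2] -/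

set_option linter.dupNamespace false

noncomputable section

open scoped TensorProduct Classical Matrix ComplexConjugate
open MeasureTheory NumberField NumberField.mixedEmbedding
open Literature.NumberTheory.Automorphic

namespace Summit.Langlands.Langlands.Theorems.HeckeEigenvalueField.Res

open ResGLnCohomology BigHeckeGLn ResGLnCone ConeDictionary

set_option maxHeartbeats 12000000 in
set_option synthInstance.maxHeartbeats 200000 in
-- heavy instance synthesis on `W ⊗ E`-valued tuple spaces
/-- **Stub ASM-END-MAIN — the algebraic end-game behind ASM-END (lead's glue).**  Given the scalar
analytic package of END-SCALAR in its second alternative (the pairings `Φ`, `Ψ` of the lifted primitive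
with the twisted cusp forms, Borel's by-parts identity, the hermitian matrices of `dE(x_b)`, and the
cochain identity read against `T.form`), the cocycle `η` is a coboundary of the level-`𝔫` relative
`(𝔤, K_∞)`-complex: pair through `⟨ , ⟩_W ⊗ adm` (END-PAIR), run the two-space adjoint lemma ADJOINT2 on
the tuple model over `xD` (END-FD: finite dimension; END-DT: `D`; END-DSTAR: `D*`; the free modules on
index tuples for the function side), and conclude with REL-EXT (`K'`-horizontal cochains agreeing on
`xD`-tuples are equal). [cite: Borel1981StableRealII, Thm. 5.2] [cite: BorelWallach2000, II §2.2–2.5] -/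
theorem stub_asm_end_main {n : ℕ} {K : Type} [Field K] [NumberField K] [NeZero n]
    (hcpt : isCompact_glFiniteIntegralLevel n K) (𝔫 : Ideal (𝓞 K)) (h𝔫 : 𝔫 ≠ 0)
    (π : CuspidalAutomorphicRepData n K hcpt) (hbot : π.1.W' = ⊥)
    (S : Finset {w : InfinitePlace K // w.IsReal}) (lam : (K →+* ℂ) → Fin n → ℤ) {q : ℕ}
    {η : Cochain π.1 lam (q + 1)} (hη : η ∈ (gkComplexLS π.1 S lam).cocycles (q + 1))
    (hfix : IsLevelFixed π.1 lam 𝔫 η)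
    (hZ : Literature.Algebra.Lie.ChevalleyEilenberg.ins q
      (⟨1, trivial⟩ : (AutomorphyDatum.gl n K hcpt).arch.lie) η = 0)
    (μA : Measure (AdelicGroupData.gl n K).automorphicQuotient)
    [(AdelicGroupData.gl n K).IsAutomorphicMeasure μA] (T : π.1.UnitaryTwist)
    (Φ : (Fin q → Fin (ResGLnCartan.pZeroDim n K)) → (∀ τ : K →+* ℂ, Fin (Module.finrank ℂ (GLnCohomology.CoeffModule ℂ n (lam τ)))) → (AdelicGroupData.gl n K).automorphicQuotient → ℂ)
    (Ψ : Fin (ResGLnCartan.pZeroDim n K) → (Fin q → Fin (ResGLnCartan.pZeroDim n K)) → (∀ τ : K →+* ℂ, Fin (Module.finrank ℂ (GLnCohomology.CoeffModule ℂ n (lam τ)))) → (AdelicGroupData.gl n K).automorphicQuotient → ℂ)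
    (hΦi : ∀ J k (y : π.1.W), Integrable (fun x => Φ J k x * conj (T.form y x)) μA)
    (hΨi : ∀ b J k (y : π.1.W), Integrable (fun x => Ψ b J k x * conj (T.form y x)) μA)
    (hbp : ∀ b J k (y : π.1.W), ∫ x, Ψ b J k x * conj (T.form y x) ∂μA =
      -∫ x, Φ J k x * conj (T.form (π.1.lieDerivW (xD n K hcpt b) y) x) ∂μA)
    (hherm : ∀ b k k',
      (AdmissibleForm.archBasis n K lam).repr (σ𝔤S hcpt lam (xD n K hcpt b) (AdmissibleForm.archBasis n K lam k')) k =
        conj ((AdmissibleForm.archBasis n K lam).repr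
          (σ𝔤S hcpt lam (xD n K hcpt b) (AdmissibleForm.archBasis n K lam k)) k'))
    (hid : ∀ (I : Fin (q + 1) → Fin (ResGLnCartan.pZeroDim n K)) k (x : (AdelicGroupData.gl n K).automorphicQuotient),
      ∑ i : Fin (q + 1), ((-1 : ℂ) ^ (i : ℕ)) *
          (Ψ (I i) (fun j => I (i.succAbove j)) k x +
            ∑ k', (AdmissibleForm.archBasis n K lam).repr
                (σ𝔤S hcpt lam (xD n K hcpt (I i)) (AdmissibleForm.archBasis n K lam k')) k *
              Φ (fun j => I (i.succAbove j)) k' x) =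
        T.form (Kuga.coordT (AdmissibleForm.archBasis n K lam)
          (@id (π.1.W ⊗[ℂ] CoeffModule ℂ n K lam) (η (fun i => xD n K hcpt (I i)))) k) x) :
    η ∈ (gkComplexLS π.1 S lam).coboundaries (q + 1) := by
  classical
  have hηc : η ∈ (gkComplexLS π.1 S lam).carrier (q + 1) :=
    (((gkComplexLS π.1 S lam).mem_cocycles_iff (q + 1) η).1 hη).1
  have hηd : Literature.Algebra.Lie.ChevalleyEilenberg.d ℝ (𝔤D n K hcpt) (Carrier π.1 lam) (q + 1) η = 0 :=
    (((gkComplexLS π.1 S lam).mem_cocycles_iff (q + 1) η).1 hη).2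
  have hηrel := mem_rel_kPrimeD_of_basic_cocycle π.1 S lam q hηc hZ hηd
  have hspan : ∀ v : 𝔤D n K hcpt, ∃ (k : 𝔤D n K hcpt) (c : Fin (ResGLnCartan.pZeroDim n K) → ℝ),
      k ∈ kPrimeD n K hcpt ∧ v = k + ∑ i, c i • xD n K hcpt i := fun v => by
    obtain ⟨k, hk, c, h⟩ := kugaD_hspan n K hcpt v; exact ⟨k, c, hk, h⟩
  obtain ⟨hipA, hipS, hipC, hipP, hLadj0⟩ := stub_end_pairing hcpt π S lam T μA
  obtain ⟨e, he⟩ : ∃ e : (π.1.W ⊗[ℂ] CoeffModule ℂ n K lam) ≃ₗ[ℂ]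
      ((∀ τ : K →+* ℂ, Fin (Module.finrank ℂ (GLnCohomology.CoeffModule ℂ n (lam τ)))) → π.1.W),
      e = Kuga.coordT (AdmissibleForm.archBasis n K lam) := ⟨_, rfl⟩
  obtain ⟨Lop, hLop⟩ : ∃ Lop : Fin (ResGLnCartan.pZeroDim n K) →
      (π.1.W ⊗[ℂ] CoeffModule ℂ n K lam) →ₗ[ℂ] (π.1.W ⊗[ℂ] CoeffModule ℂ n K lam),
      Lop = fun b => GKTensor.lie (AutomorphyDatum.gl n K hcpt).arch π.1.lieRepW (σ𝔤S hcpt lam) (xD n K hcpt b) :=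
    ⟨_, rfl⟩
  obtain ⟨LopT, hLopT_def⟩ : ∃ LopT : Fin (ResGLnCartan.pZeroDim n K) →
      (((∀ τ : K →+* ℂ, Fin (Module.finrank ℂ (GLnCohomology.CoeffModule ℂ n (lam τ)))) → π.1.W) →ₗ[ℂ] ((∀ τ : K →+* ℂ, Fin (Module.finrank ℂ (GLnCohomology.CoeffModule ℂ n (lam τ)))) → π.1.W)),
      LopT = fun b => e.toLinearMap ∘ₗ Lop b ∘ₗ e.symm.toLinearMap := ⟨_, rfl⟩
  obtain ⟨LadjT, hLadjT_def⟩ : ∃ LadjT : Fin (ResGLnCartan.pZeroDim n K) →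
      (((∀ τ : K →+* ℂ, Fin (Module.finrank ℂ (GLnCohomology.CoeffModule ℂ n (lam τ)))) → π.1.W) →ₗ[ℂ] ((∀ τ : K →+* ℂ, Fin (Module.finrank ℂ (GLnCohomology.CoeffModule ℂ n (lam τ)))) → π.1.W)),
      LadjT = fun b => -(e.toLinearMap ∘ₗ (π.1.lieRepW (xD n K hcpt b)).rTensor (CoeffModule ℂ n K lam) ∘ₗ e.symm.toLinearMap) +
        (e.toLinearMap ∘ₗ (σ𝔤S hcpt lam (xD n K hcpt b)).lTensor π.1.W ∘ₗ e.symm.toLinearMap) := ⟨_, rfl⟩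
  have hLopT : ∀ b v, LopT b v = e (Lop b (e.symm v)) := fun b v => by rw [hLopT_def]; rfl
  have hLadjT_raw : ∀ b v, LadjT b v =
      -(e ((π.1.lieRepW (xD n K hcpt b)).rTensor (CoeffModule ℂ n K lam) (e.symm v))) +
        e ((σ𝔤S hcpt lam (xD n K hcpt b)).lTensor π.1.W (e.symm v)) := fun b v => by
    rw [hLadjT_def]; rfl
  have hVneg : ∀ a c : π.1.W ⊗[ℂ] CoeffModule ℂ n K lam, e (-(a - c)) = -(e a) + e c := fun a c =>
    ((map_neg e (a - c)).trans (congrArg Neg.neg (map_sub e a c))).trans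
      ((neg_sub _ _).trans (sub_eq_neg_add _ _))
  have hLadjT : ∀ b v, LadjT b v = e (-((π.1.lieRepW (xD n K hcpt b)).rTensor (CoeffModule ℂ n K lam) (e.symm v) -
      (σ𝔤S hcpt lam (xD n K hcpt b)).lTensor π.1.W (e.symm v))) := fun b v =>
    (hLadjT_raw b v).trans (hVneg _ _).symm
  obtain ⟨ip, hip_def⟩ : ∃ ip : ((∀ τ : K →+* ℂ, Fin (Module.finrank ℂ (GLnCohomology.CoeffModule ℂ n (lam τ)))) → π.1.W) → ((∀ τ : K →+* ℂ, Fin (Module.finrank ℂ (GLnCohomology.CoeffModule ℂ n (lam τ)))) → π.1.W) → ℂ,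
      ip = fun u v => carrierForm π.1 lam (T.pet μA) (e.symm v) (e.symm u) := ⟨_, rfl⟩
  have hip_apply : ∀ u v, ip u v = carrierForm π.1 lam (T.pet μA) (e.symm v) (e.symm u) := fun u v => by
    rw [hip_def]
  have hip_add : ∀ u v w, ip (u + v) w = ip u w + ip v w := fun u v w => by rw [hip_apply, hip_apply, hip_apply, map_add, hipA]
  have hip_smul : ∀ (z : ℂ) v w, ip (z • v) w = z * ip v w := fun z v w => by rw [hip_apply, hip_apply, map_smul, hipS]
  have hip_symm : ∀ v w, ip v w = conj (ip w v) := fun v w => by rw [hip_apply, hip_apply]; exact hipC _ _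
  have hip_pos : ∀ v, v ≠ 0 → 0 < (ip v v).re := fun v hv => by
    rw [hip_apply]; exact hipP _ fun h => hv (e.symm.map_eq_zero_iff.1 h)
  have hipL : ∀ b u v, ip (LopT b u) v = ip u (LadjT b v) := fun b u v => by
    rw [hip_apply, hip_apply, hLopT, hLadjT, e.symm_apply_apply, e.symm_apply_apply, hLop]
    exact hLadj0 b _ _
  obtain ⟨Zs, hZsfd, hZs⟩ := stub_end_finiteDimensional hcpt 𝔫 h𝔫 π hbot S lam q
  haveI : Module.Finite ℂ Zs := hZsfd
  have hLF0 : ∀ k : ℕ, IsLevelFixed π.1 lam 𝔫 (0 : Cochain π.1 lam k) := fun k w u hu => by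
    simp only [AlternatingMap.zero_apply]; exact map_zero _
  let Z : Submodule ℂ ((Fin (q + 1) → Fin (ResGLnCartan.pZeroDim n K)) →
      ((∀ τ : K →+* ℂ, Fin (Module.finrank ℂ (GLnCohomology.CoeffModule ℂ n (lam τ)))) → π.1.W)) :=
    { carrier := {f | ∃ θ : Cochain π.1 lam (q + 1), θ ∈ (gkComplexLS π.1 S lam).carrier (q + 1) ∧
        θ ∈ (Literature.Algebra.Lie.ChevalleyEilenberg.Subcomplex.rel ℝ (𝔤D n K hcpt) (Carrier π.1 lam)
          (kPrimeD n K hcpt)).carrier (q + 1) ∧ IsLevelFixed π.1 lam 𝔫 θ ∧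
        f = fun I => e (@id (π.1.W ⊗[ℂ] CoeffModule ℂ n K lam) (θ (fun i => xD n K hcpt (I i))))}
      zero_mem' := ⟨0, Submodule.zero_mem _, Submodule.zero_mem _, hLF0 _, by
        funext I; exact (map_zero e).symm⟩
      add_mem' := by
        rintro f g ⟨θ, h1, h2, h3, rfl⟩ ⟨θ', h1', h2', h3', rfl⟩
        exact ⟨θ + θ', Submodule.add_mem _ h1 h1', Submodule.add_mem _ h2 h2', h3.add h3', by
          funext I; exact (map_add e _ _).symm⟩
      smul_mem' := by
        rintro z f ⟨θ, h1, h2, h3, rfl⟩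
        exact ⟨z • θ, Literature.Algebra.Lie.ChevalleyEilenberg.Subcomplex.SMulStable.smul_mem _ z θ h1,
          Literature.Algebra.Lie.ChevalleyEilenberg.Subcomplex.SMulStable.smul_mem _ z θ h2, h3.smul z, by
          funext I; exact (map_smul e _ _).symm⟩ }
  have hZle : Z ≤ Zs.map (e.toLinearMap.compLeft (Fin (q + 1) → Fin (ResGLnCartan.pZeroDim n K))) := by
    rintro f ⟨θ, h1, h2, h3, rfl⟩
    exact ⟨_, hZs θ h1 h2 h3, rfl⟩
  haveI : FiniteDimensional ℂ Z := Submodule.finiteDimensional_of_le hZle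
  let Ts : Submodule ℂ ((Fin q → Fin (ResGLnCartan.pZeroDim n K)) →
      ((∀ τ : K →+* ℂ, Fin (Module.finrank ℂ (GLnCohomology.CoeffModule ℂ n (lam τ)))) → π.1.W)) :=
    { carrier := {f | ∃ τ : Cochain π.1 lam q, τ ∈ (gkComplexLS π.1 S lam).carrier q ∧
        τ ∈ (Literature.Algebra.Lie.ChevalleyEilenberg.Subcomplex.rel ℝ (𝔤D n K hcpt) (Carrier π.1 lam)
          (kPrimeD n K hcpt)).carrier q ∧ IsLevelFixed π.1 lam 𝔫 τ ∧
        f = fun J => e (@id (π.1.W ⊗[ℂ] CoeffModule ℂ n K lam) (τ (fun j => xD n K hcpt (J j))))}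
      zero_mem' := ⟨0, Submodule.zero_mem _, Submodule.zero_mem _, hLF0 _, by
        funext J; exact (map_zero e).symm⟩
      add_mem' := by
        rintro f g ⟨τ, h1, h2, h3, rfl⟩ ⟨τ', h1', h2', h3', rfl⟩
        exact ⟨τ + τ', Submodule.add_mem _ h1 h1', Submodule.add_mem _ h2 h2', h3.add h3', by
          funext J; exact (map_add e _ _).symm⟩
      smul_mem' := by
        rintro z f ⟨τ, h1, h2, h3, rfl⟩
        exact ⟨z • τ, Literature.Algebra.Lie.ChevalleyEilenberg.Subcomplex.SMulStable.smul_mem _ z τ h1,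
          Literature.Algebra.Lie.ChevalleyEilenberg.Subcomplex.SMulStable.smul_mem _ z τ h2, h3.smul z, by
          funext J; exact (map_smul e _ _).symm⟩ }
  have hDT : ∀ τ ∈ Ts, (fun I : Fin (q + 1) → Fin (ResGLnCartan.pZeroDim n K) =>
      ∑ i : Fin (q + 1), ((-1 : ℂ) ^ (i : ℕ)) • LopT (I i) (τ fun j => I (i.succAbove j))) ∈ Z := by
    rintro τ ⟨τ', h1, h2, h3, rfl⟩
    obtain ⟨⟨hd1, hd2, hd3⟩, hdI⟩ := stub_end_dt hcpt 𝔫 π S lam τ' h1 h2 h3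
    refine ⟨_, hd1, hd2, hd3, funext fun I => ?_⟩
    rw [hdI I, map_sum]
    refine Finset.sum_congr rfl fun i _ => ?_
    rw [map_smul, hLopT, e.symm_apply_apply, hLop]
  have hDadjZ : ∀ θ ∈ Z, (fun J : Fin q → Fin (ResGLnCartan.pZeroDim n K) =>
      ∑ i : Fin (q + 1), ∑ b : Fin (ResGLnCartan.pZeroDim n K),
        ((-1 : ℂ) ^ (i : ℕ)) • LadjT b (θ (Fin.insertNth i b J))) ∈ Ts := by
    rintro θ ⟨θ', h1, h2, h3, rfl⟩
    obtain ⟨⟨hh1, hh2, hh3⟩, hhJ⟩ := stub_end_dstar hcpt 𝔫 π S lam θ' h1 h2 h3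
    refine ⟨(-(((q + 1 : ℕ) : ℂ))) • Literature.Algebra.Lie.ChevalleyEilenberg.casimirHomotopy (kugaS π.1 lam)
        (xD n K hcpt) (xD n K hcpt) q θ', ?_, ?_, ?_, funext fun J => ?_⟩
    · exact Literature.Algebra.Lie.ChevalleyEilenberg.Subcomplex.SMulStable.smul_mem _ _ _ hh1
    · exact Literature.Algebra.Lie.ChevalleyEilenberg.Subcomplex.SMulStable.smul_mem _ _ _ hh2
    · exact hh3.smul _
    · have hJ := hhJ J
      have hsum : (∑ i : Fin (q + 1), ∑ b : Fin (ResGLnCartan.pZeroDim n K), ((-1 : ℂ) ^ (i : ℕ)) •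
          LadjT b ((fun I : Fin (q + 1) → Fin (ResGLnCartan.pZeroDim n K) =>
            e (@id (π.1.W ⊗[ℂ] CoeffModule ℂ n K lam) (θ' fun i => xD n K hcpt (I i)))) (Fin.insertNth i b J))) =
          e (∑ i : Fin (q + 1), ∑ b : Fin (ResGLnCartan.pZeroDim n K), ((-1 : ℂ) ^ (i : ℕ)) •
            -(((π.1.lieRepW (xD n K hcpt b)).rTensor (CoeffModule ℂ n K lam)
                (@id (π.1.W ⊗[ℂ] CoeffModule ℂ n K lam)
                  (θ' (fun j => xD n K hcpt ((Fin.insertNth i b J : Fin (q + 1) → Fin (ResGLnCartan.pZeroDim n K)) j))))) -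
              ((σ𝔤S hcpt lam (xD n K hcpt b)).lTensor π.1.W
                (@id (π.1.W ⊗[ℂ] CoeffModule ℂ n K lam)
                  (θ' (fun j => xD n K hcpt ((Fin.insertNth i b J : Fin (q + 1) → Fin (ResGLnCartan.pZeroDim n K)) j))))))) := by
        rw [map_sum]
        refine Finset.sum_congr rfl fun i _ => ?_
        rw [map_sum]
        refine Finset.sum_congr rfl fun b _ => ?_
        rw [map_smul, hLadjT, e.symm_apply_apply]
      rw [hsum, hJ]
      refine congrArg e ?_
      exact (neg_smul ((q + 1 : ℕ) : ℂ) (_ : π.1.W ⊗[ℂ] CoeffModule ℂ n K lam)).symm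
  obtain ⟨A, hA⟩ : ∃ A : Fin (ResGLnCartan.pZeroDim n K) → (∀ τ : K →+* ℂ, Fin (Module.finrank ℂ (GLnCohomology.CoeffModule ℂ n (lam τ)))) → (∀ τ : K →+* ℂ, Fin (Module.finrank ℂ (GLnCohomology.CoeffModule ℂ n (lam τ)))) → ℂ, A = fun b k k' =>
      (AdmissibleForm.archBasis n K lam).repr (σ𝔤S hcpt lam (xD n K hcpt b) (AdmissibleForm.archBasis n K lam k')) k :=
    ⟨_, rfl⟩
  have hAm : ∀ b k k', A b k k' = LinearMap.toMatrix (AdmissibleForm.archBasis n K lam) (AdmissibleForm.archBasis n K lam)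
      (σ𝔤S hcpt lam (xD n K hcpt b)) k k' := fun b k k' => by rw [hA, LinearMap.toMatrix_apply]
  obtain ⟨c0, hc0⟩ : ∃ c0 : (Fin q → Fin (ResGLnCartan.pZeroDim n K)) → ((∀ τ : K →+* ℂ, Fin (Module.finrank ℂ (GLnCohomology.CoeffModule ℂ n (lam τ)))) → π.1.W) → ℂ, c0 = fun J v =>
      ∑ k, ∫ x, Φ J k x * conj (T.form (v k) x) ∂μA := ⟨_, rfl⟩
  obtain ⟨c1, hc1⟩ : ∃ c1 : Fin (ResGLnCartan.pZeroDim n K) → (Fin q → Fin (ResGLnCartan.pZeroDim n K)) → ((∀ τ : K →+* ℂ, Fin (Module.finrank ℂ (GLnCohomology.CoeffModule ℂ n (lam τ)))) → π.1.W) → ℂ, c1 = fun b J v =>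
      ∑ k, ∫ x, (Ψ b J k x + ∑ k', A b k k' * Φ J k' x) * conj (T.form (v k) x) ∂μA := ⟨_, rfl⟩
  have hform_add : ∀ y y' : π.1.W, T.form (y + y') = T.form y + T.form y' := fun y y' => T.form_add y y'
  have hform_smul : ∀ (z : ℂ) (y : π.1.W), T.form (z • y) = z • T.form y := fun z y => T.form_smul z y
  have hform_neg : ∀ y : π.1.W, T.form (-y) = -T.form y := fun y => by rw [← neg_one_smul ℂ y, hform_smul, neg_one_smul]
  have hGi : ∀ b J k (y : π.1.W), Integrable (fun x => (Ψ b J k x + ∑ k', A b k k' * Φ J k' x) * conj (T.form y x)) μA := by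
    intro b J k y
    have h1 : Integrable (fun x => ∑ k', A b k k' * (Φ J k' x * conj (T.form y x))) μA :=
      integrable_finsetSum _ fun k' _ => (hΦi J k' y).const_mul _
    refine ((hΨi b J k y).add h1).congr (Filter.Eventually.of_forall fun x => ?_)
    simp only [Pi.add_apply, add_mul, Finset.sum_mul, mul_assoc]
  have hc0_add : ∀ J v w, c0 J (v + w) = c0 J v + c0 J w := by
    intro J v w
    rw [hc0]
    simp only [Pi.add_apply, hform_add, map_add, mul_add, ← Finset.sum_add_distrib]
    refine Finset.sum_congr rfl fun k _ => ?_
    exact integral_add (hΦi J k (v k)) (hΦi J k (w k))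
  have hc1_add : ∀ b J v w, c1 b J (v + w) = c1 b J v + c1 b J w := by
    intro b J v w
    rw [hc1]
    simp only [Pi.add_apply, hform_add, map_add, mul_add, ← Finset.sum_add_distrib]
    refine Finset.sum_congr rfl fun k _ => ?_
    exact integral_add (hGi b J k (v k)) (hGi b J k (w k))
  obtain ⟨B'', hB''_def⟩ : ∃ B'' : ((Fin q → Fin (ResGLnCartan.pZeroDim n K)) →₀ ℂ) → ((∀ τ : K →+* ℂ, Fin (Module.finrank ℂ (GLnCohomology.CoeffModule ℂ n (lam τ)))) → π.1.W) → ℂ,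
      B'' = fun f v => f.sum fun J z => z * c0 J v := ⟨_, rfl⟩
  obtain ⟨B, hB_def⟩ : ∃ B : ((Fin (ResGLnCartan.pZeroDim n K) × (Fin q → Fin (ResGLnCartan.pZeroDim n K))) →₀ ℂ) → ((∀ τ : K →+* ℂ, Fin (Module.finrank ℂ (GLnCohomology.CoeffModule ℂ n (lam τ)))) → π.1.W) → ℂ,
      B = fun f v => f.sum fun p z => z * c1 p.1 p.2 v := ⟨_, rfl⟩
  have hB''_apply : ∀ f v, B'' f v = f.sum fun J z => z * c0 J v := fun f v => by rw [hB''_def]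
  have hB_apply : ∀ f v, B f v = f.sum fun p z => z * c1 p.1 p.2 v := fun f v => by rw [hB_def]
  have hB''_add : ∀ f v w, B'' f (v + w) = B'' f v + B'' f w := fun f v w => by
    simp only [hB''_apply, hc0_add, mul_add, Finsupp.sum_add]
  have hB_add : ∀ f v w, B f (v + w) = B f v + B f w := fun f v w => by
    simp only [hB_apply, hc1_add, mul_add, Finsupp.sum_add]
  have hB_add_left : ∀ f f' v, B (f + f') v = B f v + B f' v := fun f f' v => by
    simp only [hB_apply]
    exact Finsupp.sum_add_index' (fun p => zero_mul _) (fun p z z' => add_mul _ _ _)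
  have hB_smul_left : ∀ (z : ℂ) f v, B (z • f) v = z * B f v := fun z f v => by
    rw [hB_apply, hB_apply, Finsupp.sum_smul_index' (fun p => zero_mul _), Finsupp.mul_sum]
    exact Finsupp.sum_congr fun p _ => mul_assoc _ _ _
  have hB_lin : ∀ v, ∃ φ : ((Fin (ResGLnCartan.pZeroDim n K) × (Fin q → Fin (ResGLnCartan.pZeroDim n K))) →₀ ℂ) →ₗ[ℂ] ℂ, ∀ f, φ f = B f v := fun v =>
    ⟨{ toFun := fun f => B f v, map_add' := fun f f' => hB_add_left f f' v,
       map_smul' := fun z f => hB_smul_left z f v }, fun f => rfl⟩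
  obtain ⟨u, hu⟩ : ∃ u : (Fin q → Fin (ResGLnCartan.pZeroDim n K)) → ((Fin q → Fin (ResGLnCartan.pZeroDim n K)) →₀ ℂ), u = fun J => Finsupp.single J 1 := ⟨_, rfl⟩
  obtain ⟨Lop'', hLop''⟩ : ∃ Lop'' : Fin (ResGLnCartan.pZeroDim n K) → ((Fin q → Fin (ResGLnCartan.pZeroDim n K)) →₀ ℂ) → ((Fin (ResGLnCartan.pZeroDim n K) × (Fin q → Fin (ResGLnCartan.pZeroDim n K))) →₀ ℂ),
      Lop'' = fun b f => Finsupp.mapDomain (fun J => (b, J)) f := ⟨_, rfl⟩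
  have hco1' : ∀ b (w : π.1.W ⊗[ℂ] CoeffModule ℂ n K lam) k,
      e ((π.1.lieRepW (xD n K hcpt b)).rTensor (CoeffModule ℂ n K lam) w) k = π.1.lieRepW (xD n K hcpt b) (e w k) := by
    intro b w k; rw [he]; exact Kuga.coordT_rTensor _ _ _ _
  have hco2' : ∀ b (w : π.1.W ⊗[ℂ] CoeffModule ℂ n K lam) k,
      e ((σ𝔤S hcpt lam (xD n K hcpt b)).lTensor π.1.W w) k =
        ∑ k', LinearMap.toMatrix (AdmissibleForm.archBasis n K lam) (AdmissibleForm.archBasis n K lam)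
          (σ𝔤S hcpt lam (xD n K hcpt b)) k k' • e w k' := by
    intro b w k; rw [he]; exact Kuga.coordT_lTensor _ _ _ _
  have hLadjT_coord : ∀ b (v : (∀ τ : K →+* ℂ, Fin (Module.finrank ℂ (GLnCohomology.CoeffModule ℂ n (lam τ)))) → π.1.W) k, LadjT b v k =
      -(π.1.lieRepW (xD n K hcpt b) (v k)) + ∑ k', A b k k' • v k' := by
    intro b v k
    have hev : e (e.symm v) = v := e.apply_symm_apply v
    have hr : e ((π.1.lieRepW (xD n K hcpt b)).rTensor (CoeffModule ℂ n K lam) (e.symm v)) k =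
        π.1.lieRepW (xD n K hcpt b) (v k) :=
      (hco1' b (e.symm v) k).trans (congrArg (fun w : (∀ τ : K →+* ℂ, Fin (Module.finrank ℂ (GLnCohomology.CoeffModule ℂ n (lam τ)))) → π.1.W => π.1.lieRepW (xD n K hcpt b) (w k)) hev)
    have hl : e ((σ𝔤S hcpt lam (xD n K hcpt b)).lTensor π.1.W (e.symm v)) k = ∑ k', A b k k' • v k' :=
      ((hco2' b (e.symm v) k).trans (Finset.sum_congr rfl fun k' _ => by rw [← hAm])).trans
        (congrArg (fun w : (∀ τ : K →+* ℂ, Fin (Module.finrank ℂ (GLnCohomology.CoeffModule ℂ n (lam τ)))) → π.1.W => ∑ k', A b k k' • w k') hev)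
    have h := congrFun (hLadjT_raw b v) k
    rw [Pi.add_apply, Pi.neg_apply] at h
    exact h.trans (congrArg₂ (fun (p r : π.1.W) => -p + r) hr hl)
  have hform_sum : ∀ {ι' : Type} (t : Finset ι') (f : ι' → π.1.W), T.form (∑ i ∈ t, f i) = ∑ i ∈ t, T.form (f i) := by
    intro ι' t f
    induction t using Finset.induction_on with
    | empty => rw [Finset.sum_empty, Finset.sum_empty, ← zero_smul ℂ (0 : π.1.W), hform_smul, zero_smul]
    | insert a t ha ih => rw [Finset.sum_insert ha, Finset.sum_insert ha, hform_add, ih]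
  have hkey : ∀ b J v, c1 b J v = c0 J (LadjT b v) := by
    intro b J v
    have hw : ∀ k x, conj (T.form (LadjT b v k) x) =
        -conj (T.form (π.1.lieRepW (xD n K hcpt b) (v k)) x) + ∑ k', conj (A b k k') * conj (T.form (v k') x) := by
      intro k x
      rw [hLadjT_coord, hform_add, hform_neg, hform_sum]
      simp only [hform_smul, Pi.add_apply, Pi.neg_apply, Finset.sum_apply, Pi.smul_apply, smul_eq_mul, map_add,
        map_neg, map_sum, map_mul]
    have h0 : c0 J (LadjT b v) = ∑ k, (-(∫ x, Φ J k x * conj (T.form (π.1.lieRepW (xD n K hcpt b) (v k)) x) ∂μA) +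
        ∑ k', conj (A b k k') * ∫ x, Φ J k x * conj (T.form (v k') x) ∂μA) := by
      rw [hc0]
      refine Finset.sum_congr rfl fun k _ => ?_
      have hint1 := hΦi J k (π.1.lieRepW (xD n K hcpt b) (v k))
      have hint2 : ∀ k', Integrable (fun x => conj (A b k k') * (Φ J k x * conj (T.form (v k') x))) μA :=
        fun k' => (hΦi J k (v k')).const_mul _
      simp only [hw, mul_add, mul_neg, Finset.mul_sum]
      have hint3 : ∀ k', Integrable (fun x => Φ J k x * (conj (A b k k') * conj (T.form (v k') x))) μA :=
        fun k' => (hint2 k').congr (Filter.Eventually.of_forall fun x => by ring)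
      rw [integral_add hint1.fun_neg (integrable_finsetSum _ fun k' _ => hint3 k'), integral_neg,
        integral_finsetSum _ fun k' _ => hint3 k']
      congr 1
      refine Finset.sum_congr rfl fun k' _ => ?_
      rw [← integral_const_mul]
      exact integral_congr_ae (Filter.Eventually.of_forall fun x => by ring)
    have h1 : c1 b J v = ∑ k, ((∫ x, Ψ b J k x * conj (T.form (v k) x) ∂μA) +
        ∑ k', A b k k' * ∫ x, Φ J k' x * conj (T.form (v k) x) ∂μA) := by
      rw [hc1]
      refine Finset.sum_congr rfl fun k _ => ?_
      have hint2 : ∀ k', Integrable (fun x => A b k k' * (Φ J k' x * conj (T.form (v k) x))) μA :=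
        fun k' => (hΦi J k' (v k)).const_mul _
      simp only [add_mul, Finset.sum_mul, mul_assoc]
      rw [integral_add (hΨi b J k (v k)) (integrable_finsetSum _ fun k' _ => hint2 k'),
        integral_finsetSum _ fun k' _ => hint2 k']
      congr 1
      exact Finset.sum_congr rfl fun k' _ => integral_const_mul _ _
    rw [h0, h1, Finset.sum_add_distrib, Finset.sum_add_distrib]
    congr 1
    · exact Finset.sum_congr rfl fun k _ => hbp b J k (v k)
    · rw [Finset.sum_comm]
      refine Finset.sum_congr rfl fun k _ => Finset.sum_congr rfl fun k' _ => ?_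
      have hhermA : A b k k' = conj (A b k' k) := by rw [hA]; exact hherm b k k'
      rw [hhermA, Complex.conj_conj]
  have hL' : ∀ b f v, B (Lop'' b f) v = B'' f (LadjT b v) := by
    intro b f v
    rw [hB_apply, hB''_apply, hLop'']
    simp only
    rw [Finsupp.sum_mapDomain_index_inj (fun J J' h => (Prod.mk.inj h).2)]
    exact Finsupp.sum_congr fun J _ => by rw [hkey]
  obtain ⟨ηT, hηT⟩ : ∃ ηT : (Fin (q + 1) → Fin (ResGLnCartan.pZeroDim n K)) → ((∀ τ : K →+* ℂ, Fin (Module.finrank ℂ (GLnCohomology.CoeffModule ℂ n (lam τ)))) → π.1.W), ηT = fun I =>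
      e (@id (π.1.W ⊗[ℂ] CoeffModule ℂ n K lam) (η (fun i => xD n K hcpt (I i)))) := ⟨_, rfl⟩
  have hηTZ : ηT ∈ Z := ⟨η, hηc, hηrel, hfix, hηT⟩
  have hprim : ∀ (I : Fin (q + 1) → Fin (ResGLnCartan.pZeroDim n K)) (v : (∀ τ : K →+* ℂ, Fin (Module.finrank ℂ (GLnCohomology.CoeffModule ℂ n (lam τ)))) → π.1.W), ip (ηT I) v =
      B (∑ i : Fin (q + 1), ((-1 : ℂ) ^ (i : ℕ)) • Lop'' (I i) (u fun j => I (i.succAbove j))) v := by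
    intro I v
    obtain ⟨φ, hφ⟩ := hB_lin v
    have hR : B (∑ i : Fin (q + 1), ((-1 : ℂ) ^ (i : ℕ)) • Lop'' (I i) (u fun j => I (i.succAbove j))) v =
        ∑ i : Fin (q + 1), ((-1 : ℂ) ^ (i : ℕ)) * c1 (I i) (fun j => I (i.succAbove j)) v := by
      rw [← hφ, map_sum]
      refine Finset.sum_congr rfl fun i _ => ?_
      rw [map_smul, smul_eq_mul, hφ, hLop'', hu]
      simp only
      rw [Finsupp.mapDomain_single, hB_apply, Finsupp.sum_single_index (zero_mul _), one_mul]
    have hL : ip (ηT I) v = ∑ k, ∫ x, conj (T.form (v k) x) *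
        T.form (Kuga.coordT (AdmissibleForm.archBasis n K lam)
          (@id (π.1.W ⊗[ℂ] CoeffModule ℂ n K lam) (η (fun i => xD n K hcpt (I i)))) k) x ∂μA := by
      rw [hip_apply, hηT]
      simp only
      rw [e.symm_apply_apply]
      change Kuga.tensorForm (T.pet μA) (AdmissibleForm.archBasis n K lam) _ _ = _
      rw [Kuga.tensorForm_apply]
      refine Finset.sum_congr rfl fun k _ => ?_
      rw [← he, e.apply_symm_apply]
      rfl
    rw [hR, hL]
    have hG : ∀ i k, Integrable (fun x => (Ψ (I i) (fun j => I (i.succAbove j)) k x +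
        ∑ k', A (I i) k k' * Φ (fun j => I (i.succAbove j)) k' x) * conj (T.form (v k) x)) μA :=
      fun i k => hGi (I i) _ k (v k)
    have hstep : ∀ k, (∫ x, conj (T.form (v k) x) *
        T.form (Kuga.coordT (AdmissibleForm.archBasis n K lam)
          (@id (π.1.W ⊗[ℂ] CoeffModule ℂ n K lam) (η (fun i => xD n K hcpt (I i)))) k) x ∂μA) =
        ∑ i : Fin (q + 1), ((-1 : ℂ) ^ (i : ℕ)) * ∫ x, (Ψ (I i) (fun j => I (i.succAbove j)) k x +
          ∑ k', A (I i) k k' * Φ (fun j => I (i.succAbove j)) k' x) * conj (T.form (v k) x) ∂μA := by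
      intro k
      have hpt : ∀ x, conj (T.form (v k) x) *
          T.form (Kuga.coordT (AdmissibleForm.archBasis n K lam)
            (@id (π.1.W ⊗[ℂ] CoeffModule ℂ n K lam) (η (fun i => xD n K hcpt (I i)))) k) x =
          ∑ i : Fin (q + 1), ((-1 : ℂ) ^ (i : ℕ)) * ((Ψ (I i) (fun j => I (i.succAbove j)) k x +
            ∑ k', A (I i) k k' * Φ (fun j => I (i.succAbove j)) k' x) * conj (T.form (v k) x)) := by
        intro x
        rw [← hid I k x, hA, mul_comm, Finset.sum_mul]
        refine Finset.sum_congr rfl fun i _ => ?_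
        ring
      rw [integral_congr_ae (Filter.Eventually.of_forall hpt), integral_finsetSum _ fun i _ => (hG i k).const_mul _]
      exact Finset.sum_congr rfl fun i _ => integral_const_mul _ _
    simp only [hstep]
    rw [Finset.sum_comm]
    refine Finset.sum_congr rfl fun i _ => ?_
    rw [hc1, Finset.mul_sum]
  obtain ⟨τ, ⟨τ', h1, h2, h3, rfl⟩, hDτ⟩ := stub_mem_range_of_pairedPrimitive_two ip hip_add hip_smul hip_symm hip_pos
    B hB_add hB_add_left hB_smul_left B'' hB''_add LopT LadjT hipL Lop'' hL' Z Ts hDT hDadjZ ηT hηTZ u hprim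
  obtain ⟨⟨hd1, hd2, hd3⟩, hdI⟩ := stub_end_dt hcpt 𝔫 π S lam τ' h1 h2 h3
  have hηh : η ∈ Literature.Algebra.Lie.ChevalleyEilenberg.horizontal (kPrimeD n K hcpt) (q + 1) :=
    (Submodule.mem_inf.1 hηrel).2
  have hdh : Literature.Algebra.Lie.ChevalleyEilenberg.d ℝ (𝔤D n K hcpt) (Carrier π.1 lam) q τ' ∈
      Literature.Algebra.Lie.ChevalleyEilenberg.horizontal (kPrimeD n K hcpt) (q + 1) :=
    (Submodule.mem_inf.1 hd2).2
  have hdeq : Literature.Algebra.Lie.ChevalleyEilenberg.d ℝ (𝔤D n K hcpt) (Carrier π.1 lam) q τ' = η := by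
    refine stub_eq_of_horizontal_of_basisTuple (kPrimeD n K hcpt) (xD n K hcpt) hspan _ _ hdh hηh fun I => ?_
    have hI := congrFun hDτ I
    rw [hηT] at hI
    simp only at hI
    have hI' : e (@id (π.1.W ⊗[ℂ] CoeffModule ℂ n K lam)
        (Literature.Algebra.Lie.ChevalleyEilenberg.d ℝ (𝔤D n K hcpt) (Carrier π.1 lam) q τ'
          (fun i => xD n K hcpt (I i)))) =
        e (@id (π.1.W ⊗[ℂ] CoeffModule ℂ n K lam) (η (fun i => xD n K hcpt (I i)))) := by
      rw [← hI, hdI I, map_sum]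
      refine Finset.sum_congr rfl fun i _ => ?_
      rw [map_smul, hLopT, e.symm_apply_apply, hLop]
    exact e.injective hI'
  rw [Literature.Algebra.Lie.ChevalleyEilenberg.Subcomplex.mem_coboundaries_succ_iff]
  exact ⟨τ', h1, hdeq⟩

end Summit.Langlands.Langlands.Theorems.HeckeEigenvalueField.Res

end
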